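import Summits.AtomisticToContinuum.Crystallization.Theorems.FreeSplittingCertificatesStrictSplittingRuleP1FarCellLoad20

/-!
# `StrictSplittingRule` (stmt-AtomisticToContinuum-12560): toward the (B∃) tail from `12a` — the midpoint tension with its junk term (any `r ≥ ‖y_s‖`), and PER-KIND moment bounds (P1 interpolant object, part 99)

Route `FreeSplittingCertificates`, crux r3 `StrictSplittingRule` (H12⋆ = `stub_coreJointCoercive`), unit b2b-freesplit-B gen 40.
VALUE = groundwork for the per-kind sharpening of parts 94–98 (kernel radius `20a → 12a`, HOME CERT §39 (b)(iv): with PER-KIND inflation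
factors `Λ_in = (53/50)(103/100)³ = 1.158`, `Λ_v = (5/4)(11/10)³ = 1.664` and fresh per-class `LDLᵀ` forms the budget closes at `12a` with
margin `7 %`).  This file supplies the two analytic inputs at the smaller radius:
* `h1_tau_midpoint_junk` — the midpoint form of the tension for ANY `r ≥ ‖y_s‖`, keeping the (tiny, positive) junk term
  `r⁻¹⁴(¼r‖y_s‖ + (7/4)‖y_s‖²)` that parts 84/94 absorbed under `r ≥ 12‖y_s‖` / `r ≥ (51/5)‖y_s‖`;
  `h1_tau_midpoint_num10` (`(5/4)`, `r ≥ 10`, `‖y_s‖ ≤ 8/5`), `h1_tau_midpoint_num_in12` (`(53/50)`, `r ≥ 23/2`, `‖y_s‖ ≤ 1`), `p1Beta_half_le_mid10`, `p1FarWv_le_mid10`, `p1Beta_half_le_mid_in12`, `p1FarW_le_mid_in12`;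
* `p1CarCheckIn` (in-layer classes pass the SHARPER lever check `|ū − μ| ≤ 1/10`, by `decide`), `check_real_in`, `moment_abstract_gen`,
  **`carriers_moment_le_v`** (`X = (11/10)m_b²`, `m_b ≥ 217/20`) / **`carriers_moment_le_in`** (`X = (103/100)m_b²`, `m_b ≥ 58/5`).
NOT a proof of H12⋆, NOT summit progress.  [folklore]
-/

noncomputable section

open Set Function Metric MeasureTheory Filter Topology
open scoped BigOperators NNReal ENNReal Classical

namespace Summit.AtomisticToContinuum.Crystallization.Theorems.StrictSplittingRuleBirth

open Literature.MathematicalPhysics.StatisticalMechanics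
open Summit.AtomisticToContinuum.Crystallization.Theorems.PalmUnimodularRigidity.LayeredLawsSelectHcp

/-! ## The midpoint tension with its junk term -/

section Tau6

variable {a h : ℝ} {V : Bool → ℤ × ℤ × ℤ → EuclideanSpace ℝ (Fin 3)} {F : Bool → (ℤ × ℤ × ℤ) → (ℤ × ℤ × ℤ) → ℤ → ℝ}
  {τ : Bool → (ℤ × ℤ × ℤ) → (ℤ × ℤ × ℤ) → ℝ}

/-- **The midpoint form of the tension for any `r ≥ ‖y_s‖`**: `τ ≤ (1/12)(m²)⁻³ + ½E²r⁻⁸ + r⁻¹⁴(¼rE + (7/4)E²)` (`E = ‖y_s‖`, `r = ‖V c d‖`,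
`m² = ‖V c d + ½y_s‖²`; `h1_tau_asymp2` + the tangent of `X⁻³`; the junk term is `≤ 2·10⁻⁶` of the main term from `r ≥ 10`). [folklore] -/
theorem h1_tau_midpoint_junk (ha : 0 < a) (hh : 0 < h)
    (hV : ∀ c d, V c d = if c = true then hcpSite a h d else -hcpSite a h (-d))
    (hF : ∀ c s d n, F c s d n =
      ljSqDeriv (‖V c (d + n • s)‖ ^ 2) * inner ℝ (V c (d + n • s)) (hcpSite a h s))
    (hτ : ∀ c s d, τ c s d = if 0 ≤ inner ℝ (V c d) (hcpSite a h s) then ∑' m : ℕ, F c s d ((m : ℤ) + 1)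
      else -(F c s d 0 + ∑' m : ℕ, F c s d (-((m : ℤ) + 1))))
    (c : Bool) {s : ℤ × ℤ × ℤ} (hs : s ∈ ({(0, 1, 0), (0, 0, 1), (0, -1, 1), (2, 0, 0)} : Finset (ℤ × ℤ × ℤ)))
    {d : ℤ × ℤ × ℤ} (hd : d ≠ 0) (hr : ‖hcpSite a h s‖ ≤ ‖V c d‖) :
    τ c s d ≤ 1 / 12 * ((‖V c d + (1 / 2 : ℝ) • hcpSite a h s‖ ^ 2)⁻¹) ^ 3 +
      1 / 2 * ‖hcpSite a h s‖ ^ 2 * (‖V c d‖⁻¹) ^ 8 +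
      (‖V c d‖⁻¹) ^ 14 * (1 / 4 * ‖V c d‖ * ‖hcpSite a h s‖ + 7 / 4 * ‖hcpSite a h s‖ ^ 2) := by
  have h2 := h1_tau_asymp2 ha hh hV hF hτ c hs hd
  set e := hcpSite a h s with he_def
  set v := V c d with hv_def
  set r := ‖v‖ with hr_def
  set E := ‖e‖ with hE_def
  set P := inner ℝ v e with hP_def
  have hρ : 0 < min a h := lt_min ha hh
  have hr0 : 0 < r := hρ.trans_le (h1_V_norm_ge ha hh hV c hd)
  have hE0 : 0 ≤ E := norm_nonneg _
  have hPle : P ≤ r * E := real_inner_le_norm v e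
  have hPge : -(r * E) ≤ P := by
    have := real_inner_le_norm v (-e)
    rw [inner_neg_right, norm_neg] at this
    linarith
  have hm2 : ‖v + (1 / 2 : ℝ) • e‖ ^ 2 = r ^ 2 + P + 1 / 4 * E ^ 2 := by
    rw [h1_line_norm_sq]; ring
  have hm0 : 0 < ‖v + (1 / 2 : ℝ) • e‖ ^ 2 := by
    rw [hm2]; nlinarith
  have hup : τ c s d ≤ -(1 / 2 * lennardJones r) - 1 / 2 * (ljSqDeriv (r ^ 2) * P) +
      (14 + 56 * (r⁻¹) ^ 6) / 32 * (E ^ 2 * (r⁻¹) ^ 8) := by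
    have := (abs_le.mp h2).2; linarith
  have htan := inv_cube_tangent hm0 (by positivity : (0 : ℝ) < r ^ 2)
  rw [hm2] at htan ⊢
  have hid1 : ((r ^ 2)⁻¹) ^ 3 - 3 * ((r ^ 2)⁻¹) ^ 4 * (r ^ 2 + P + 1 / 4 * E ^ 2 - r ^ 2) =
      (r⁻¹) ^ 6 - 3 * (r⁻¹) ^ 8 * P - 3 / 4 * E ^ 2 * (r⁻¹) ^ 8 := by
    rw [inv_pow, inv_pow, ← pow_mul, ← pow_mul, inv_pow, inv_pow]; ring
  rw [hid1] at htan
  have hid : -(1 / 2 * lennardJones r) - 1 / 2 * (ljSqDeriv (r ^ 2) * P) + (14 + 56 * (r⁻¹) ^ 6) / 32 * (E ^ 2 * (r⁻¹) ^ 8) -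
      (1 / 12 * ((r⁻¹) ^ 6 - 3 * (r⁻¹) ^ 8 * P - 3 / 4 * E ^ 2 * (r⁻¹) ^ 8) + 1 / 2 * E ^ 2 * (r⁻¹) ^ 8) =
      (r⁻¹) ^ 14 * (1 / 4 * P + 7 / 4 * E ^ 2) - (r⁻¹) ^ 14 * (r ^ 2 / 24) := by
    rw [lennardJones, ljSqDeriv]
    field_simp
    ring
  have hx0 : 0 ≤ (r⁻¹) ^ 14 := by positivity
  have hj : (r⁻¹) ^ 14 * (1 / 4 * P + 7 / 4 * E ^ 2) ≤ (r⁻¹) ^ 14 * (1 / 4 * r * E + 7 / 4 * E ^ 2) :=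
    mul_le_mul_of_nonneg_left (by linarith) hx0
  have hneg : 0 ≤ (r⁻¹) ^ 14 * (r ^ 2 / 24) := by positivity
  linarith [hup, htan, hid, hj, hneg]
set_option maxHeartbeats 400000 in
/-- **Numerical midpoint form from `r ≥ 10`, `‖y_s‖ ≤ 8/5`** (vertical bonds at `12a − 2h`): `τ ≤ (1/12)(5/4)·(m²)⁻³`
(`6t²(1 + t/2)⁶ ≤ 0.2438` at `t = E/r ≤ 4/25`, junk `≤ 2·10⁻⁶`). [folklore] -/
theorem h1_tau_midpoint_num10 (ha : 0 < a) (hh : 0 < h)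
    (hV : ∀ c d, V c d = if c = true then hcpSite a h d else -hcpSite a h (-d))
    (hF : ∀ c s d n, F c s d n =
      ljSqDeriv (‖V c (d + n • s)‖ ^ 2) * inner ℝ (V c (d + n • s)) (hcpSite a h s))
    (hτ : ∀ c s d, τ c s d = if 0 ≤ inner ℝ (V c d) (hcpSite a h s) then ∑' m : ℕ, F c s d ((m : ℤ) + 1)
      else -(F c s d 0 + ∑' m : ℕ, F c s d (-((m : ℤ) + 1))))
    (c : Bool) {s : ℤ × ℤ × ℤ} (hs : s ∈ ({(0, 1, 0), (0, 0, 1), (0, -1, 1), (2, 0, 0)} : Finset (ℤ × ℤ × ℤ)))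
    {d : ℤ × ℤ × ℤ} (hd : d ≠ 0) (hys : ‖hcpSite a h s‖ ≤ 8 / 5) (hr : 10 ≤ ‖V c d‖) :
    τ c s d ≤ 1 / 12 * (5 / 4) * ((‖V c d + (1 / 2 : ℝ) • hcpSite a h s‖ ^ 2)⁻¹) ^ 3 := by
  set e := hcpSite a h s with he_def
  set v := V c d with hv_def
  set r := ‖v‖ with hr_def
  set E := ‖e‖ with hE_def
  have hE0 : 0 ≤ E := norm_nonneg _
  have hr0 : 0 < r := lt_of_lt_of_le (by norm_num) hr
  have hEr : E ≤ r := by linarith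
  have hmid := h1_tau_midpoint_junk ha hh hV hF hτ c hs hd hEr
  set P := inner ℝ v e with hP_def
  have hPle : P ≤ r * E := real_inner_le_norm v e
  have hm2 : ‖v + (1 / 2 : ℝ) • e‖ ^ 2 = r ^ 2 + P + 1 / 4 * E ^ 2 := by
    rw [h1_line_norm_sq]; ring
  have hPge : -(r * E) ≤ P := by
    have := real_inner_le_norm v (-e)
    rw [inner_neg_right, norm_neg] at this
    linarith
  have hm0 : 0 < ‖v + (1 / 2 : ℝ) • e‖ ^ 2 := by rw [hm2]; nlinarith
  have hmle : ‖v + (1 / 2 : ℝ) • e‖ ^ 2 ≤ (r + E / 2) ^ 2 := by rw [hm2]; nlinarith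
  -- `t = E/r ≤ 4/25`, `u = 1/r ≤ 1/10`
  have ht : E / r ≤ 4 / 25 := by rw [div_le_iff₀ hr0]; linarith
  have ht0 : 0 ≤ E / r := by positivity
  have hu : r⁻¹ ≤ 1 / 10 := by rw [inv_le_comm₀ hr0 (by norm_num)]; linarith
  have hu0 : 0 ≤ r⁻¹ := by positivity
  -- the three terms times `12(r + E/2)⁶` against `1/4`
  have hpoly1 : (E / r) ^ 2 * (1 + E / r / 2) ^ 6 ≤ 40624 / 1000000 := by
    calc (E / r) ^ 2 * (1 + E / r / 2) ^ 6 ≤ (4 / 25 : ℝ) ^ 2 * (1 + 4 / 25 / 2) ^ 6 := by gcongr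
      _ ≤ 40624 / 1000000 := by norm_num
  have hpoly2 : (E / r) * (1 + E / r / 2) ^ 6 * (r⁻¹) ^ 6 ≤ 1 / 1000000 := by
    calc (E / r) * (1 + E / r / 2) ^ 6 * (r⁻¹) ^ 6 ≤ (4 / 25 : ℝ) * (1 + 4 / 25 / 2) ^ 6 * (1 / 10) ^ 6 := by gcongr
      _ ≤ 1 / 1000000 := by norm_num
  have hpoly3 : (E / r) ^ 2 * (1 + E / r / 2) ^ 6 * (r⁻¹) ^ 6 ≤ 1 / 1000000 := by
    calc (E / r) ^ 2 * (1 + E / r / 2) ^ 6 * (r⁻¹) ^ 6 ≤ (4 / 25 : ℝ) ^ 2 * (1 + 4 / 25 / 2) ^ 6 * (1 / 10) ^ 6 := by gcongr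
      _ ≤ 1 / 1000000 := by norm_num
  have hr' : r ≠ 0 := hr0.ne'
  have hkey : (1 / 2 * E ^ 2 * (r⁻¹) ^ 8 + (r⁻¹) ^ 14 * (1 / 4 * r * E + 7 / 4 * E ^ 2)) * (r + E / 2) ^ 6 ≤ 1 / 12 * (1 / 4) := by
    have e1 : 1 / 2 * E ^ 2 * (r⁻¹) ^ 8 * (r + E / 2) ^ 6 = 1 / 2 * ((E / r) ^ 2 * (1 + E / r / 2) ^ 6) := by
      rw [div_eq_mul_inv E r]; field_simp
    have e2 : (r⁻¹) ^ 14 * (1 / 4 * r * E) * (r + E / 2) ^ 6 = 1 / 4 * ((E / r) * (1 + E / r / 2) ^ 6 * (r⁻¹) ^ 6) := by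
      rw [div_eq_mul_inv E r]; field_simp
    have e3 : (r⁻¹) ^ 14 * (7 / 4 * E ^ 2) * (r + E / 2) ^ 6 = 7 / 4 * ((E / r) ^ 2 * (1 + E / r / 2) ^ 6 * (r⁻¹) ^ 6) := by
      rw [div_eq_mul_inv E r]; field_simp
    have expand : (1 / 2 * E ^ 2 * (r⁻¹) ^ 8 + (r⁻¹) ^ 14 * (1 / 4 * r * E + 7 / 4 * E ^ 2)) * (r + E / 2) ^ 6 =
        1 / 2 * E ^ 2 * (r⁻¹) ^ 8 * (r + E / 2) ^ 6 + (r⁻¹) ^ 14 * (1 / 4 * r * E) * (r + E / 2) ^ 6 +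
          (r⁻¹) ^ 14 * (7 / 4 * E ^ 2) * (r + E / 2) ^ 6 := by ring
    rw [expand, e1, e2, e3]
    linarith [hpoly1, hpoly2, hpoly3]
  have hinv : ((‖v + (1 / 2 : ℝ) • e‖ ^ 2)⁻¹) ^ 3 * (r + E / 2) ^ 6 ≥ 1 := by
    have h3 : (‖v + (1 / 2 : ℝ) • e‖ ^ 2) ^ 3 ≤ ((r + E / 2) ^ 2) ^ 3 := by gcongr
    have h4 : ((r + E / 2) ^ 2) ^ 3 = (r + E / 2) ^ 6 := by ring
    rw [h4] at h3
    have h5 : ((‖v + (1 / 2 : ℝ) • e‖ ^ 2)⁻¹) ^ 3 * (‖v + (1 / 2 : ℝ) • e‖ ^ 2) ^ 3 = 1 := by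
      rw [← mul_pow, inv_mul_cancel₀ hm0.ne', one_pow]
    calc (1 : ℝ) = ((‖v + (1 / 2 : ℝ) • e‖ ^ 2)⁻¹) ^ 3 * (‖v + (1 / 2 : ℝ) • e‖ ^ 2) ^ 3 := h5.symm
      _ ≤ ((‖v + (1 / 2 : ℝ) • e‖ ^ 2)⁻¹) ^ 3 * (r + E / 2) ^ 6 := by gcongr
  have hX0 : 0 ≤ ((‖v + (1 / 2 : ℝ) • e‖ ^ 2)⁻¹) ^ 3 := by positivity
  have hJ0 : 0 ≤ 1 / 2 * E ^ 2 * (r⁻¹) ^ 8 + (r⁻¹) ^ 14 * (1 / 4 * r * E + 7 / 4 * E ^ 2) := by positivity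
  have hfin : 1 / 2 * E ^ 2 * (r⁻¹) ^ 8 + (r⁻¹) ^ 14 * (1 / 4 * r * E + 7 / 4 * E ^ 2) ≤
      1 / 12 * (1 / 4) * ((‖v + (1 / 2 : ℝ) • e‖ ^ 2)⁻¹) ^ 3 := by
    have h6 := mul_le_mul_of_nonneg_left hkey hX0
    nlinarith [mul_le_mul_of_nonneg_left hinv hJ0]
  linarith [hmid, hfin]

/-- **Numerical midpoint form from `r ≥ 23/2`, `‖y_s‖ ≤ 1`** (in-layer bonds at `12a`): `τ ≤ (1/12)(53/50)·(m²)⁻³`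
(`6t²(1 + t/2)⁶ ≤ 0.0588` at `t ≤ 2/23`). [folklore] -/
theorem h1_tau_midpoint_num_in12 (ha : 0 < a) (hh : 0 < h)
    (hV : ∀ c d, V c d = if c = true then hcpSite a h d else -hcpSite a h (-d))
    (hF : ∀ c s d n, F c s d n =
      ljSqDeriv (‖V c (d + n • s)‖ ^ 2) * inner ℝ (V c (d + n • s)) (hcpSite a h s))
    (hτ : ∀ c s d, τ c s d = if 0 ≤ inner ℝ (V c d) (hcpSite a h s) then ∑' m : ℕ, F c s d ((m : ℤ) + 1)
      else -(F c s d 0 + ∑' m : ℕ, F c s d (-((m : ℤ) + 1))))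
    (c : Bool) {s : ℤ × ℤ × ℤ} (hs : s ∈ ({(0, 1, 0), (0, 0, 1), (0, -1, 1), (2, 0, 0)} : Finset (ℤ × ℤ × ℤ)))
    {d : ℤ × ℤ × ℤ} (hd : d ≠ 0) (hys : ‖hcpSite a h s‖ ≤ 1) (hr : 23 / 2 ≤ ‖V c d‖) :
    τ c s d ≤ 1 / 12 * (53 / 50) * ((‖V c d + (1 / 2 : ℝ) • hcpSite a h s‖ ^ 2)⁻¹) ^ 3 := by
  set e := hcpSite a h s with he_def
  set v := V c d with hv_def
  set r := ‖v‖ with hr_def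
  set E := ‖e‖ with hE_def
  have hE0 : 0 ≤ E := norm_nonneg _
  have hr0 : 0 < r := lt_of_lt_of_le (by norm_num) hr
  have h10 : 51 / 5 * E ≤ r := by linarith
  have hmid := h1_tau_midpoint10 ha hh hV hF hτ c hs hd h10
  set P := inner ℝ v e with hP_def
  have hPle : P ≤ r * E := real_inner_le_norm v e
  have hm2 : ‖v + (1 / 2 : ℝ) • e‖ ^ 2 = r ^ 2 + P + 1 / 4 * E ^ 2 := by
    rw [h1_line_norm_sq]; ring
  have hPge : -(r * E) ≤ P := by
    have := real_inner_le_norm v (-e)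
    rw [inner_neg_right, norm_neg] at this
    linarith
  have hm0 : 0 < ‖v + (1 / 2 : ℝ) • e‖ ^ 2 := by rw [hm2]; nlinarith
  have hmle : ‖v + (1 / 2 : ℝ) • e‖ ^ 2 ≤ (r + E / 2) ^ 2 := by rw [hm2]; nlinarith
  have ht : E / r ≤ 2 / 23 := by rw [div_le_iff₀ hr0]; linarith
  have ht0 : 0 ≤ E / r := by positivity
  have hpoly : (E / r) ^ 2 * (1 + E / r / 2) ^ 6 ≤ 1 / 100 := by
    calc (E / r) ^ 2 * (1 + E / r / 2) ^ 6 ≤ (2 / 23 : ℝ) ^ 2 * (1 + 2 / 23 / 2) ^ 6 := by gcongr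
      _ ≤ 1 / 100 := by norm_num
  have hkey : E ^ 2 * (r⁻¹) ^ 8 * (r + E / 2) ^ 6 ≤ 1 / 100 := by
    have hid : E ^ 2 * (r⁻¹) ^ 8 * (r + E / 2) ^ 6 = (E / r) ^ 2 * (1 + E / r / 2) ^ 6 := by
      have hr' : r ≠ 0 := hr0.ne'
      rw [div_eq_mul_inv E r, inv_eq_one_div]
      field_simp
    rw [hid]; exact hpoly
  have hinv : ((‖v + (1 / 2 : ℝ) • e‖ ^ 2)⁻¹) ^ 3 * (r + E / 2) ^ 6 ≥ 1 := by
    have h3 : (‖v + (1 / 2 : ℝ) • e‖ ^ 2) ^ 3 ≤ ((r + E / 2) ^ 2) ^ 3 := by gcongr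
    have h4 : ((r + E / 2) ^ 2) ^ 3 = (r + E / 2) ^ 6 := by ring
    rw [h4] at h3
    have h5 : ((‖v + (1 / 2 : ℝ) • e‖ ^ 2)⁻¹) ^ 3 * (‖v + (1 / 2 : ℝ) • e‖ ^ 2) ^ 3 = 1 := by
      rw [← mul_pow, inv_mul_cancel₀ hm0.ne', one_pow]
    calc (1 : ℝ) = ((‖v + (1 / 2 : ℝ) • e‖ ^ 2)⁻¹) ^ 3 * (‖v + (1 / 2 : ℝ) • e‖ ^ 2) ^ 3 := h5.symm
      _ ≤ ((‖v + (1 / 2 : ℝ) • e‖ ^ 2)⁻¹) ^ 3 * (r + E / 2) ^ 6 := by gcongr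
  have hX0 : 0 ≤ ((‖v + (1 / 2 : ℝ) • e‖ ^ 2)⁻¹) ^ 3 := by positivity
  have hfin : 1 / 2 * E ^ 2 * (r⁻¹) ^ 8 ≤ 1 / 12 * (3 / 50) * ((‖v + (1 / 2 : ℝ) • e‖ ^ 2)⁻¹) ^ 3 := by
    have h6 := mul_le_mul_of_nonneg_left hkey hX0
    have h7 : 0 ≤ E ^ 2 * (r⁻¹) ^ 8 := by positivity
    nlinarith [mul_le_mul_of_nonneg_left hinv h7]
  linarith [hmid, hfin]

end Tau6

/-- **`½β ≤ (λ_SV/24)(5/4)·m⁻⁶` for the vertical bond from `‖y_q − y_p‖ ≥ 10`** (box `a ≤ 8/5`, `h ≤ 4/5`). [folklore] -/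
theorem p1Beta_half_le_mid10 {a h : ℝ} (ha : 0 < a) (hh : 0 < h) (ha' : a ≤ 8 / 5) (hh' : h ≤ 4 / 5) (p q : ℤ × ℤ × ℤ)
    (hqp : q ≠ p) (hr : 10 ≤ ‖hcpSite a h q - hcpSite a h p‖) :
    1 / 2 * p1Beta a h (decide (Even q.1)) (p - q) p1SV ≤
      p1TrussLam a h p1SV / 24 * (5 / 4) * ((‖(hcpSite a h q - hcpSite a h p) + (1 / 2 : ℝ) • hcpSite a h p1SV‖ ^ 2)⁻¹) ^ 3 := by
  have hs : p1SV ∈ p1Stencil := p1SV_mem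
  rw [p1Beta_of_mem a h _ _ _ hs]
  have hpar : (if Even (p - q).1 then decide (Even q.1) else !decide (Even q.1)) = decide (Even p.1) := by
    show (if Even (p.1 - q.1) then _ else _) = _
    by_cases hp : Even p.1 <;> by_cases hq : Even q.1 <;> simp [hp, hq, Int.even_sub]
  have hcov : p1TrussV a h (decide (Even p.1)) (q - p) = hcpSite a h q - hcpSite a h p := by
    have := h1_sub_eq a h p (q - p)
    rw [add_sub_cancel] at this
    rw [this, p1TrussV_eq]
    simp
  have hd : q - p ≠ 0 := sub_ne_zero.2 hqp
  have hys := norm_p1Stencil_le ha hh ha' hh' hs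
  have hb := h1_tau_midpoint_num10 ha hh (p1TrussV_eq a h) (p1TrussF_eq a h) (p1TrussTau_eq a h) (decide (Even p.1))
    (p1Stencil_eq ▸ hs) hd hys (by rw [hcov]; exact hr)
  rw [hcov] at hb
  rw [hpar, neg_sub]
  have hlam : 0 ≤ p1TrussLam a h p1SV := by rw [p1TrussLam_eq]; split_ifs <;> positivity
  have := mul_le_mul_of_nonneg_left hb hlam
  linarith

/-- The vertical far share at the midpoint from `‖y_q − y_p‖ ≥ 10` (constant `5/4`). [folklore] -/
theorem p1FarWv_le_mid10 {a h : ℝ} (ha : 0 < a) (hh : 0 < h) (ha' : a ≤ 8 / 5) (hh' : h ≤ 4 / 5)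
    (φ : Finset ((ℤ × ℤ × ℤ) × (ℤ × ℤ × ℤ))) (p q : ℤ × ℤ × ℤ) (hqp : q ≠ p) (hr : 10 ≤ ‖hcpSite a h q - hcpSite a h p‖) :
    p1FarWv a h φ p q ≤
      p1TrussLam a h p1SV / 24 * (5 / 4) * ((‖(hcpSite a h q - hcpSite a h p) + (1 / 2 : ℝ) • hcpSite a h p1SV‖ ^ 2)⁻¹) ^ 3 := by
  have hlam : 0 ≤ p1TrussLam a h p1SV := by rw [p1TrussLam_eq]; split_ifs <;> positivity
  exact p1FarWv_le_of φ p q (by positivity) fun _ => p1Beta_half_le_mid10 ha hh ha' hh' p q hqp hr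

/-- **`½β ≤ (λ_s/24)(53/50)·m⁻⁶` for an IN-LAYER bond from `‖y_q − y_p‖ ≥ 23/2`** (`‖y_s‖ = a ≤ 1`). [folklore] -/
theorem p1Beta_half_le_mid_in12 {a h : ℝ} (ha : 0 < a) (hh : 0 < h) (ha1 : a ≤ 1) (p q : ℤ × ℤ × ℤ)
    {s : ℤ × ℤ × ℤ} (hs : s ∈ p1StencilIn) (hqp : q ≠ p) (hr : 23 / 2 ≤ ‖hcpSite a h q - hcpSite a h p‖) :
    1 / 2 * p1Beta a h (decide (Even q.1)) (p - q) s ≤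
      p1TrussLam a h s / 24 * (53 / 50) * ((‖(hcpSite a h q - hcpSite a h p) + (1 / 2 : ℝ) • hcpSite a h s‖ ^ 2)⁻¹) ^ 3 := by
  have hs' : s ∈ p1Stencil := p1StencilIn_subset hs
  rw [p1Beta_of_mem a h _ _ _ hs']
  have hpar : (if Even (p - q).1 then decide (Even q.1) else !decide (Even q.1)) = decide (Even p.1) := by
    show (if Even (p.1 - q.1) then _ else _) = _
    by_cases hp : Even p.1 <;> by_cases hq : Even q.1 <;> simp [hp, hq, Int.even_sub]
  have hcov : p1TrussV a h (decide (Even p.1)) (q - p) = hcpSite a h q - hcpSite a h p := by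
    have := h1_sub_eq a h p (q - p)
    rw [add_sub_cancel] at this
    rw [this, p1TrussV_eq]
    simp
  have hd : q - p ≠ 0 := sub_ne_zero.2 hqp
  have hys : ‖hcpSite a h s‖ ≤ 1 := by rw [norm_stencilIn ha hs]; exact ha1
  have hb := h1_tau_midpoint_num_in12 ha hh (p1TrussV_eq a h) (p1TrussF_eq a h) (p1TrussTau_eq a h) (decide (Even p.1))
    (p1Stencil_eq ▸ hs') hd hys (by rw [hcov]; exact hr)
  rw [hcov] at hb
  rw [hpar, neg_sub]
  have hlam : 0 ≤ p1TrussLam a h s := by rw [p1TrussLam_eq]; split_ifs <;> positivity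
  have := mul_le_mul_of_nonneg_left hb hlam
  linarith

/-- The in-layer far share at the midpoint from `‖y_q − y_p‖ ≥ 23/2` (constant `53/50`). [folklore] -/
theorem p1FarW_le_mid_in12 {a h : ℝ} (ha : 0 < a) (hh : 0 < h) (ha1 : a ≤ 1)
    (φ : Finset ((ℤ × ℤ × ℤ) × (ℤ × ℤ × ℤ))) (p q s : ℤ × ℤ × ℤ) (hs : s ∈ p1StencilIn) (hqp : q ≠ p)
    (hr : 23 / 2 ≤ ‖hcpSite a h q - hcpSite a h p‖) :
    p1FarW a h φ p (q, s) ≤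
      p1TrussLam a h s / 24 * (53 / 50) * ((‖(hcpSite a h q - hcpSite a h p) + (1 / 2 : ℝ) • hcpSite a h s‖ ^ 2)⁻¹) ^ 3 := by
  have hlam : 0 ≤ p1TrussLam a h s := by rw [p1TrussLam_eq]; split_ifs <;> positivity
  exact p1FarW_le_of φ p (q, s) (by positivity) fun _ _ => p1Beta_half_le_mid_in12 ha hh ha1 p q hs hqp hr

/-! ## Per-kind moment bounds -/

/-- **The SHARPER lever check of an in-layer class**: `9437(3K₁² + K₂²) + 75480K₃² ≤ 4800N²` (i.e. `|ū − μ| ≤ 1/10` on the box). [folklore] -/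
def p1CarCheckIn (b : Bool) (d : ℤ × ℤ × ℤ) : Prop :=
  9437 * (3 * (2 * (p1CarS1 b d).1 - 4 * (p1Carriers b d).card * (p1Frame b d).1) ^ 2 +
      (2 * (p1CarS1 b d).2.1 - 4 * (p1Carriers b d).card * (p1Frame b d).2.1) ^ 2) +
    75480 * (2 * (p1CarS1 b d).2.2 - 4 * (p1Carriers b d).card * (p1Frame b d).2.2) ^ 2 ≤ 4800 * (4 * (p1Carriers b d).card : ℤ) ^ 2

/-- The sharper lever check is a decidable integer inequality. -/
instance instDecidableP1CarCheckIn (b : Bool) (d : ℤ × ℤ × ℤ) : Decidable (p1CarCheckIn b d) := by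
  unfold p1CarCheckIn; infer_instance

/-- The in-layer classes pass the sharper lever check, both parities (by `decide`; `|ū − μ| = 0.096a / 0.072a`). -/
theorem p1CarCheckIn_all : ∀ b : Bool, ∀ d ∈ p1StencilIn, p1CarCheckIn b d := by decide

/-- The sharper lever check implies `|Φ(S)/N − Φ(F_b(d))/2|² ≤ (1/10)²` on the box. -/
theorem check_real_in {a h : ℝ} (ha : 0 < a) (hh : 0 < h) (ha2 : a ≤ 97139 / 100000) (hh2 : h ≤ 79304 / 100000)
    {n : ℕ} (hn : 0 < n) {S Mv : ℤ × ℤ × ℤ}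
    (hW : 9437 * (3 * (2 * S.1 - 4 * (n : ℤ) * Mv.1) ^ 2 + (2 * S.2.1 - 4 * (n : ℤ) * Mv.2.1) ^ 2) +
      75480 * (2 * S.2.2 - 4 * (n : ℤ) * Mv.2.2) ^ 2 ≤ 4800 * (4 * (n : ℤ)) ^ 2) :
    fpSq (fun k => p1FrameVec a h S k / (4 * (n : ℝ)) - p1FrameVec a h Mv k / 2) ≤ (1 / 10) ^ 2 := by
  have hsa : a ^ 2 ≤ 9437 / 10000 := by nlinarith
  have hsh : h ^ 2 ≤ 6290 / 10000 := by nlinarith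
  have h3 : (√3 : ℝ) ^ 2 = 3 := Real.sq_sqrt (by norm_num)
  have hnR : (0 : ℝ) < (n : ℝ) := by exact_mod_cast hn
  have hW' : (9437 : ℝ) * (3 * (2 * (S.1 : ℝ) - 4 * (n : ℝ) * (Mv.1 : ℝ)) ^ 2 + (2 * (S.2.1 : ℝ) - 4 * (n : ℝ) * (Mv.2.1 : ℝ)) ^ 2) +
      75480 * (2 * (S.2.2 : ℝ) - 4 * (n : ℝ) * (Mv.2.2 : ℝ)) ^ 2 ≤ 4800 * (4 * (n : ℝ)) ^ 2 := by exact_mod_cast hW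
  have hn' : (n : ℝ) ≠ 0 := hnR.ne'
  have e0 : p1FrameVec a h S 0 / (4 * (n : ℝ)) - p1FrameVec a h Mv 0 / 2 =
      a / 2 * (2 * (S.1 : ℝ) - 4 * (n : ℝ) * (Mv.1 : ℝ)) / (8 * (n : ℝ)) := by
    simp only [p1FrameVec_apply0]; field_simp; ring
  have e1 : p1FrameVec a h S 1 / (4 * (n : ℝ)) - p1FrameVec a h Mv 1 / 2 =
      a * √3 / 6 * (2 * (S.2.1 : ℝ) - 4 * (n : ℝ) * (Mv.2.1 : ℝ)) / (8 * (n : ℝ)) := by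
    simp only [p1FrameVec_apply1]; field_simp; ring
  have e2 : p1FrameVec a h S 2 / (4 * (n : ℝ)) - p1FrameVec a h Mv 2 / 2 =
      h * (2 * (S.2.2 : ℝ) - 4 * (n : ℝ) * (Mv.2.2 : ℝ)) / (8 * (n : ℝ)) := by
    simp only [p1FrameVec_apply2]; field_simp; ring
  have hsq : fpSq (fun k => p1FrameVec a h S k / (4 * (n : ℝ)) - p1FrameVec a h Mv k / 2) =
      ((a / 2) ^ 2 * (2 * (S.1 : ℝ) - 4 * (n : ℝ) * (Mv.1 : ℝ)) ^ 2 + (a * √3 / 6) ^ 2 * (2 * (S.2.1 : ℝ) - 4 * (n : ℝ) * (Mv.2.1 : ℝ)) ^ 2 +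
        h ^ 2 * (2 * (S.2.2 : ℝ) - 4 * (n : ℝ) * (Mv.2.2 : ℝ)) ^ 2) / (8 * (n : ℝ)) ^ 2 := by
    simp only [fpSq, e0, e1, e2]
    field_simp
  have h36 : (a * √3 / 6) ^ 2 = a ^ 2 / 12 := by
    rw [show (a * √3 / 6) ^ 2 = a ^ 2 * (√3) ^ 2 / 36 by ring, h3]; ring
  rw [hsq, h36, div_le_iff₀ (by positivity)]
  nlinarith [mul_le_mul_of_nonneg_right hsa (sq_nonneg (2 * (S.1 : ℝ) - 4 * (n : ℝ) * (Mv.1 : ℝ))),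
    mul_le_mul_of_nonneg_right hsa (sq_nonneg (2 * (S.2.1 : ℝ) - 4 * (n : ℝ) * (Mv.2.1 : ℝ))),
    mul_le_mul_of_nonneg_right hsh (sq_nonneg (2 * (S.2.2 : ℝ) - 4 * (n : ℝ) * (Mv.2.2 : ℝ)))]

/-- **The abstract moment bound with parameters**: `N|D|² + 2⟨D,U⟩ + Q ≤ N·c·m²` from `|D + μ| = m ≥ m₀`, `|U/N − μ| ≤ L`, `Q − |U|²/N ≤ (3/5)N`
and the scalar fact `(m + L)² + 3/5 ≤ c·m²`. [folklore] -/
theorem moment_abstract_gen {N : ℝ} {D U μ : Fin 3 → ℝ} {Q m L c : ℝ} (hN : 0 < N) (hm0 : 0 ≤ m) (hL0 : 0 ≤ L) (hDμ : fpSq (D + μ) = m ^ 2)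
    (hw : fpSq (fun k => U k / N - μ k) ≤ L ^ 2) (hvar : Q - fpSq U / N ≤ 3 / 5 * N) (hsc : (m + L) ^ 2 + 3 / 5 ≤ c * m ^ 2) :
    N * fpSq D + 2 * fpDot D U + Q ≤ N * (c * m ^ 2) := by
  have e : N * fpSq D + 2 * fpDot D U = N * fpSq (D + fun k => U k / N) - fpSq U / N := by
    have hN' : N ≠ 0 := hN.ne'
    simp only [fpSq, fpDot, Pi.add_apply]
    field_simp
    ring
  have hsplit : (D + fun k => U k / N) = (D + μ) + (fun k => U k / N - μ k) := by
    funext k; simp only [Pi.add_apply]; ring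
  have hadd : fpSq (D + fun k => U k / N) ≤ (m + L) ^ 2 := by
    rw [hsplit]; exact fpSq_add_le_sq hm0 hL0 hDμ hw
  rw [e]
  have h1 : N * fpSq (D + fun k => U k / N) ≤ N * (m + L) ^ 2 := mul_le_mul_of_nonneg_left hadd hN.le
  have h3 := mul_le_mul_of_nonneg_left hsc hN.le
  linarith

/-- **Moment hypothesis of the Jensen capacity for a ROUTE leg at `12a`**: `X = (11/10)m_b²`, `m_b ≥ 217/20` (lever `1/2`, `(m + 1/2)² + 3/5 ≤ (11/10)m²`). -/
theorem carriers_moment_le_v {a h : ℝ} (ha : 0 < a) (hh : 0 < h) (ha2 : a ≤ 97139 / 100000) (hh2 : h ≤ 79304 / 100000)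
    (p x d : ℤ × ℤ × ℤ) {b : Bool} (hb : p1Par x = b) {Mv : ℤ × ℤ × ℤ} (hchk : p1CarCheck b d Mv) (hn : 0 < (p1Carriers b d).card)
    {m : ℝ} (hm0 : 0 ≤ m) (hm : 217 / 20 ≤ m)
    (hDμ : fpSq ((fun k => hcpSite a h x k - hcpSite a h p k) + fun k => p1FrameVec a h Mv k / 2) = m ^ 2) :
    √3 * a ^ 2 * h / 48 * ∑ oπ ∈ p1Carriers b d, ∑ m' : Fin 4,
        fpSq (fun k => hcpSite a h ((x - oπ.1) + p1VertOff (p1Par (x - oπ.1)) oπ.2 m') k - hcpSite a h p k) ≤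
      ((p1Carriers b d).card : ℝ) * (√3 * a ^ 2 * h / 12) * (11 / 10 * m ^ 2) := by
  rw [carrier_moment_eq a h hb d]
  obtain ⟨hW, hA1, hA2, hA3, hV⟩ := hchk
  obtain ⟨hw, hvar⟩ := check_real ha hh ha2 hh2 hn hW hA1 hA2 hA3 hV
  have hN : (0 : ℝ) < 4 * ((p1Carriers b d).card : ℝ) := by positivity
  have hsc : (m + 1 / 2) ^ 2 + 3 / 5 ≤ 11 / 10 * m ^ 2 := by nlinarith [mul_nonneg (sub_nonneg.2 hm) hm0]
  have key := moment_abstract_gen (D := fun k => hcpSite a h x k - hcpSite a h p k) (U := p1FrameVec a h (p1CarS1 b d))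
    (μ := fun k => p1FrameVec a h Mv k / 2) hN hm0 (by norm_num) hDμ hw hvar hsc
  have hV0 : 0 ≤ √3 * a ^ 2 * h / 48 := by positivity
  have := mul_le_mul_of_nonneg_left key hV0
  refine le_trans this (le_of_eq ?_)
  ring

/-- **Moment hypothesis of the Jensen capacity for an IN-LAYER leg at `12a`**: `X = (103/100)m_b²`, `m_b ≥ 58/5` (lever `1/10`, `(m + 1/10)² + 3/5 ≤ (103/100)m²`). -/
theorem carriers_moment_le_in {a h : ℝ} (ha : 0 < a) (hh : 0 < h) (ha2 : a ≤ 97139 / 100000) (hh2 : h ≤ 79304 / 100000)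
    (p x d : ℤ × ℤ × ℤ) {b : Bool} (hb : p1Par x = b) (hd : d ∈ p1StencilIn) (hn : 0 < (p1Carriers b d).card)
    {m : ℝ} (hm0 : 0 ≤ m) (hm : 58 / 5 ≤ m)
    (hDμ : fpSq ((fun k => hcpSite a h x k - hcpSite a h p k) + fun k => p1FrameVec a h (p1Frame b d) k / 2) = m ^ 2) :
    √3 * a ^ 2 * h / 48 * ∑ oπ ∈ p1Carriers b d, ∑ m' : Fin 4,
        fpSq (fun k => hcpSite a h ((x - oπ.1) + p1VertOff (p1Par (x - oπ.1)) oπ.2 m') k - hcpSite a h p k) ≤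
      ((p1Carriers b d).card : ℝ) * (√3 * a ^ 2 * h / 12) * (103 / 100 * m ^ 2) := by
  rw [carrier_moment_eq a h hb d]
  obtain ⟨-, hA1, hA2, hA3, hV⟩ := p1CarCheck_in b d hd
  have hWin := p1CarCheckIn_all b d hd
  unfold p1CarCheckIn at hWin
  obtain ⟨-, hvar⟩ := check_real ha hh ha2 hh2 hn (p1CarCheck_in b d hd).1 hA1 hA2 hA3 hV
  have hw := check_real_in ha hh ha2 hh2 hn hWin
  have hN : (0 : ℝ) < 4 * ((p1Carriers b d).card : ℝ) := by positivity
  have hsc : (m + 1 / 10) ^ 2 + 3 / 5 ≤ 103 / 100 * m ^ 2 := by nlinarith [mul_nonneg (sub_nonneg.2 hm) hm0]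
  have key := moment_abstract_gen (D := fun k => hcpSite a h x k - hcpSite a h p k) (U := p1FrameVec a h (p1CarS1 b d))
    (μ := fun k => p1FrameVec a h (p1Frame b d) k / 2) hN hm0 (by norm_num) hDμ hw hvar hsc
  have hV0 : 0 ≤ √3 * a ^ 2 * h / 48 := by positivity
  have := mul_le_mul_of_nonneg_left key hV0
  refine le_trans this (le_of_eq ?_)
  ring

end Summit.AtomisticToContinuum.Crystallization.Theorems.StrictSplittingRuleBirth

end
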